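import Literature.Computability.AlgebraicComplexity.QuasiPolynomialFormulasProofs
import Literature.Computability.AlgebraicComplexity.DetInVP
import Literature.Computability.AlgebraicComplexity.IMMInVPProofs
import Literature.Computability.AlgebraicComplexity.ArithCircuitProofs
import Literature.Computability.AlgebraicComplexity.DeterminantalComplexityProofs
import Literature.Computability.AlgebraicComplexity.BenOrCleveIMMThree
import Summits.ValiantsHypothesis.ValiantsHypothesis.Theorems.LacunarySymmetroidMatrixDescartesCensusKLawBridge
import Summits.ValiantsHypothesis.ValiantsHypothesis.Theses.KPlusLogSqLaw
import Summits.ValiantsHypothesis.ValiantsHypothesis.Theorems.LacunarySymmetroidMatrixDescartesCensusTropicalKLawBridges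
import Summits.ValiantsHypothesis.ValiantsHypothesis.Theorems.LacunarySymmetroidAssembly

/-!
# Sketch — crux idea `lacunary-formula-law` (lens = embed, seat val-idea-17 g2) for
`LacunarySymmetroid.MatrixDescartes` (stmt-ValiantsHypothesis-18050), cross-noted for `KPlusLogSqLaw.TropicalB` (stmt-19771).

HOST CONJECTURE (the structural statement "elsewhere" = real-fewnomial theory of arithmetic FORMULAS with high-powered inputs):
`RealFormulaLaw` (RFL): a real polynomial `P(y₁,…,y_K)` of fan-in-two FORMULA size `s`, restricted to the monomial curve
`y_l = t^{d_l}`, has at most `2^{O(K)} · poly(s)` distinct real zeros.  The symmetric lacunary pencil determinant is the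
instance `P = det(∑ y_l S_l)`, whose formula size is `2^{O(log²m + log²K)}` by the tree's Berkowitz + Hyafil/VSBR facts
(`complexity_detPoly_le`, `formulaComplexity_le_two_pow`), so RFL specialises to the cell's Conjecture B (`KPlusLogSqLaw`,
exponent `K + log² m`) and hence to `MatrixDescartes` (`Census.matrixDescartes_of_kPlusLogSqLaw`, tree).  Nothing here is
proved about RFL, B, `MatrixDescartes`, `TropicalB` or VP ≠ VNP; the theorems below are the DICTIONARY only.
-/

set_option linter.dupNamespace false
set_option autoImplicit false

namespace Summit.ValiantsHypothesis.ValiantsHypothesis.Cruxes.MatrixDescartes.LacunaryFormulaLaw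

open Literature.Computability.AlgebraicComplexity
open Summit.ValiantsHypothesis.ValiantsHypothesis.Theorems.LacunarySymmetroidMatrixDescartes (RealRootLawAt KPlusLogSqLaw)

/-- `Z_d(P)`: the number of distinct real zeros of `P(t^{d 0}, …, t^{d (K-1)})` (the zero polynomial has none). -/
noncomputable def curveRootCount {K : ℕ} (d : Fin K → ℕ) (P : MvPolynomial (Fin K) ℝ) : ℕ :=
  (MvPolynomial.aeval (fun l : Fin K => (Polynomial.X : Polynomial ℝ) ^ d l) P).roots.toFinset.card

/-- **RFL — the lacunary real formula law** (host conjecture of the embed, rev 1; a CONJECTURE, never asserted; PRICED —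
rev 2 / crit-4 VERDICT #4 P1: RFL ⟹ `DET ∉ VF_ℝ`, kernel `FormulaLawSandwich.not_detInVF_of_realFormulaLaw` in the g3 file; the
unpriced host of record is `FormulaLawSandwich.FormulaLaw 2`):
`Z_d(P) ≤ 2^{C·K} · (E(P) + 2)^C` with `E` = fan-in-two formula complexity over `ℝ` (`formulaComplexity`). -/
def RealFormulaLaw : Prop :=
  ∃ C : ℕ, ∀ (K : ℕ) (d : Fin K → ℕ) (P : MvPolynomial (Fin K) ℝ),
    curveRootCount d P ≤ 2 ^ (C * K) * (formulaComplexity P + 2) ^ C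

/-- row predicate of RFL (census style): every `P` in `K` letters of formula complexity `≤ s` has `Z_d(P) ≤ B`. -/
def RealFormulaLawAt (K s B : ℕ) : Prop :=
  ∀ (d : Fin K → ℕ) (P : MvPolynomial (Fin K) ℝ), formulaComplexity P ≤ s → curveRootCount d P ≤ B

/-- the SYMBOLIC pencil determinant `det(∑ l, y_l • S_l) ∈ ℝ[y₁,…,y_K]`. -/
noncomputable def pencilDet {m K : ℕ} (S : Fin K → Matrix (Fin m) (Fin m) ℝ) : MvPolynomial (Fin K) ℝ :=
  Matrix.det (∑ l, (MvPolynomial.X l : MvPolynomial (Fin K) ℝ) • (S l).map MvPolynomial.C)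

/-- DICTIONARY (i): on the curve `y_l = X^{d l}` the symbolic determinant is the crux's lacunary pencil determinant. -/
theorem aeval_pencilDet {m K : ℕ} (d : Fin K → ℕ) (S : Fin K → Matrix (Fin m) (Fin m) ℝ) :
    MvPolynomial.aeval (fun l : Fin K => (Polynomial.X : Polynomial ℝ) ^ d l) (pencilDet S)
      = Matrix.det (∑ l, ((Polynomial.X : Polynomial ℝ) ^ d l) • (S l).map Polynomial.C) := by
  unfold pencilDet
  rw [AlgHom.map_det, map_sum]
  congr 1
  refine Finset.sum_congr rfl fun l _ => ?_
  ext i j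
  simp [AlgHom.mapMatrix_apply, Matrix.map_apply, Matrix.smul_apply, Polynomial.algebraMap_eq]

/-- hence the crux's root count is the curve root count of `pencilDet`. -/
theorem curveRootCount_pencilDet {m K : ℕ} (d : Fin K → ℕ) (S : Fin K → Matrix (Fin m) (Fin m) ℝ) :
    curveRootCount d (pencilDet S)
      = (Matrix.det (∑ l, ((Polynomial.X : Polynomial ℝ) ^ d l) • (S l).map Polynomial.C)).roots.toFinset.card := by
  rw [curveRootCount, aeval_pencilDet]

/-- the linear entries `∑ l, S_l(i,j) • y_l`. -/
noncomputable def pencilEntry {m K : ℕ} (S : Fin K → Matrix (Fin m) (Fin m) ℝ) (p : Fin m × Fin m) :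
    MvPolynomial (Fin K) ℝ :=
  ∑ l, (S l p.1 p.2) • (MvPolynomial.X l : MvPolynomial (Fin K) ℝ)

/-- DICTIONARY (ii): `pencilDet S` is the projection of the generic determinant `DET_m` under `X_{ij} ↦ ∑ l, S_l(i,j) y_l`. -/
theorem pencilDet_eq_aeval_detPoly {m K : ℕ} (S : Fin K → Matrix (Fin m) (Fin m) ℝ) :
    pencilDet S = MvPolynomial.aeval (pencilEntry S) (detPoly (Fin m) ℝ) := by
  unfold pencilDet detPoly
  rw [AlgHom.map_det]
  have h : (MvPolynomial.aeval (pencilEntry S)).mapMatrix (Matrix.mvPolynomialX (Fin m) (Fin m) ℝ)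
      = Matrix.of (fun i j => pencilEntry S (i, j)) :=
    Matrix.mvPolynomialX_mapMatrix_aeval (R := ℝ) (Matrix.of fun i j => pencilEntry S (i, j))
  rw [h]
  congr 1
  refine Matrix.ext fun i j => ?_
  simp only [pencilEntry, Matrix.sum_apply, Matrix.smul_apply, Matrix.map_apply, Matrix.of_apply,
    MvPolynomial.smul_eq_C_mul, smul_eq_mul, mul_comm]

/-- each linear entry costs at most `2K` gates. -/
theorem complexity_pencilEntry_le {m K : ℕ} (S : Fin K → Matrix (Fin m) (Fin m) ℝ) (p : Fin m × Fin m) :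
    complexity (pencilEntry S p) ≤ 2 * K := by
  unfold pencilEntry
  refine (complexity_finset_sum_le _ _).trans ?_
  have h1 : ∀ l : Fin K, complexity ((S l p.1 p.2) • (MvPolynomial.X l : MvPolynomial (Fin K) ℝ)) ≤ 1 := by
    intro l
    refine (complexity_smul_le_holds _ _).trans ?_
    rw [complexity_X_holds]
  calc ∑ l, complexity ((S l p.1 p.2) • (MvPolynomial.X l : MvPolynomial (Fin K) ℝ)) + (Finset.univ : Finset (Fin K)).card
      ≤ ∑ _l : Fin K, 1 + (Finset.univ : Finset (Fin K)).card := Nat.add_le_add_right (Finset.sum_le_sum fun l _ => h1 l) _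
    _ = 2 * K := by simp [Finset.card_univ]; ring

/-- DICTIONARY (iii): circuit complexity of the symbolic pencil determinant: Berkowitz (`complexity_detPoly_le`) + substitution. -/
theorem complexity_pencilDet_le {m K : ℕ} (S : Fin K → Matrix (Fin m) (Fin m) ℝ) :
    complexity (pencilDet S) ≤ 8 * (m + 1) ^ 7 + m ^ 2 * (2 * K) := by
  rw [pencilDet_eq_aeval_detPoly]
  refine (complexity_aeval_le _ _).trans ?_
  refine Nat.add_le_add (complexity_detPoly_le ℝ m) ?_
  calc ∑ p : Fin m × Fin m, complexity (pencilEntry S p)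
      ≤ ∑ _p : Fin m × Fin m, 2 * K := Finset.sum_le_sum fun p _ => complexity_pencilEntry_le S p
    _ = m ^ 2 * (2 * K) := by simp [Finset.card_univ, Fintype.card_prod, Fintype.card_fin, sq]

/-- DICTIONARY (iv): total degree `≤ m`. -/
theorem totalDegree_pencilDet_le {m K : ℕ} (S : Fin K → Matrix (Fin m) (Fin m) ℝ) :
    (pencilDet S).totalDegree ≤ m := by
  rw [pencilDet_eq_aeval_detPoly]
  have h1 : ∀ p, (pencilEntry S p).totalDegree ≤ 1 := by
    intro p
    unfold pencilEntry
    refine (MvPolynomial.totalDegree_finsetSum_le fun l _ => ?_)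
    refine (MvPolynomial.totalDegree_smul_le _ _).trans ?_
    simp
  refine (HasDetRepr.totalDegree_aeval_le_of_le_one _ h1 _).trans ?_
  simpa using (detPoly_isHomogeneous (n := Fin m) (k := ℝ)).totalDegree_le

/-- DICTIONARY (v): FORMULA size of the symbolic pencil determinant is quasi-polynomial: `≤ 2^{18 E²}` for any `E ≥ 1`
with `8(m+1)^7 + 2Km² ≤ 2^E` (so `E = O(log m + log K)`), by Hyafil/VSBR depth reduction (`formulaComplexity_le_two_pow`). -/
theorem formulaComplexity_pencilDet_le {m K E : ℕ} (S : Fin K → Matrix (Fin m) (Fin m) ℝ)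
    (hE : 1 ≤ E) (hsize : 8 * (m + 1) ^ 7 + m ^ 2 * (2 * K) ≤ 2 ^ E) (hK : K ≤ 2 ^ E) :
    formulaComplexity (pencilDet S) ≤ 2 ^ (18 * E ^ 2) := by
  have hm : m < 2 ^ E := by
    have h7 : m < 8 * (m + 1) ^ 7 := by
      calc m < m + 1 := Nat.lt_succ_self m
        _ ≤ (m + 1) ^ 7 := Nat.le_self_pow (by norm_num) _
        _ ≤ 8 * (m + 1) ^ 7 := Nat.le_mul_of_pos_left _ (by norm_num)
    omega
  exact formulaComplexity_le_two_pow (totalDegree_pencilDet_le S) hm (by simpa using hK)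
    ((complexity_pencilDet_le S).trans hsize) hE

/-- **FIRST LEMMA of the line (the embedding): RFL ⇒ Conjecture B.**  Stated as a `Prop` (proved below:
`firstLemma_proof`; the content beyond the dictionary (i)–(v) is the arithmetic
`2^{CK}·(2^{18E(m,K)²}+2)^C ≤ 2^{C_B (K + log² m)}`, using `log₂² (K+1) ≤ K + 16`). -/
def FirstLemma : Prop := RealFormulaLaw → KPlusLogSqLaw

/-! ### arithmetic for the first lemma -/

theorem two_mul_add_one_le_two_pow : ∀ n : ℕ, 3 ≤ n → 2 * n + 1 ≤ 2 ^ n := by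
  intro n hn
  induction n, hn using Nat.le_induction with
  | base => norm_num
  | succ n hn ih =>
    calc 2 * (n + 1) + 1 = (2 * n + 1) + 2 := by ring
      _ ≤ 2 ^ n + 2 ^ n := Nat.add_le_add ih (by
          calc (2 : ℕ) = 2 ^ 1 := by norm_num
            _ ≤ 2 ^ n := Nat.pow_le_pow_right (by norm_num) (by omega))
      _ = 2 ^ (n + 1) := by ring

theorem sq_le_two_pow_add : ∀ n : ℕ, n ^ 2 ≤ 2 ^ n + 15 := by
  intro n
  induction n with
  | zero => norm_num
  | succ n ih =>
    by_cases h : n < 3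
    · interval_cases n <;> norm_num
    · have h2 := two_mul_add_one_le_two_pow n (by omega)
      calc (n + 1) ^ 2 = n ^ 2 + (2 * n + 1) := by ring
        _ ≤ (2 ^ n + 15) + 2 ^ n := Nat.add_le_add ih h2
        _ = 2 ^ (n + 1) + 15 := by ring

/-- `log₂²(K+1) ≤ K + 16`. -/
theorem log_succ_sq_le (K : ℕ) : Nat.log 2 (K + 1) ^ 2 ≤ K + 16 := by
  have h1 : 2 ^ Nat.log 2 (K + 1) ≤ K + 1 := Nat.pow_log_le_self 2 (by omega)
  have h2 := sq_le_two_pow_add (Nat.log 2 (K + 1))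
  omega

/-- `log₂(m+1) ≤ log₂ m + 1`. -/
theorem log_succ_le (m : ℕ) : Nat.log 2 (m + 1) ≤ Nat.log 2 m + 1 := by
  have h1 : 2 ^ Nat.log 2 (m + 1) ≤ m + 1 := Nat.pow_log_le_self 2 (by omega)
  have h2 : m < 2 ^ (Nat.log 2 m + 1) := Nat.lt_pow_succ_log_self (by norm_num) m
  have h3 : 2 ^ Nat.log 2 (m + 1) ≤ 2 ^ (Nat.log 2 m + 1) := by omega
  exact (Nat.pow_le_pow_iff_right (by norm_num)).1 h3

/-- the size budget `E(m,K) = 7·log₂(m+1) + log₂(K+1) + 11` dominates the circuit size of `pencilDet` and `K`. -/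
theorem size_le_two_pow_E (m K : ℕ) :
    8 * (m + 1) ^ 7 + m ^ 2 * (2 * K) ≤ 2 ^ (7 * Nat.log 2 (m + 1) + Nat.log 2 (K + 1) + 11) ∧
      K ≤ 2 ^ (7 * Nat.log 2 (m + 1) + Nat.log 2 (K + 1) + 11) := by
  set a := Nat.log 2 (m + 1) with ha
  set j := Nat.log 2 (K + 1) with hj
  have hm : m + 1 < 2 ^ (a + 1) := Nat.lt_pow_succ_log_self (by norm_num) (m + 1)
  have hK : K + 1 < 2 ^ (j + 1) := Nat.lt_pow_succ_log_self (by norm_num) (K + 1)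
  have h7 : (m + 1) ^ 7 ≤ (2 ^ (a + 1)) ^ 7 := Nat.pow_le_pow_left hm.le 7
  have h7' : 8 * (m + 1) ^ 7 ≤ 2 ^ (7 * a + 10) := by
    calc 8 * (m + 1) ^ 7 ≤ 8 * (2 ^ (a + 1)) ^ 7 := Nat.mul_le_mul_left 8 h7
      _ = 2 ^ (7 * a + 10) := by rw [← pow_mul, show (8 : ℕ) = 2 ^ 3 by norm_num, ← pow_add]; ring_nf
  have hsq : m ^ 2 ≤ 2 ^ (2 * a + 2) := by
    calc m ^ 2 ≤ (m + 1) ^ 2 := Nat.pow_le_pow_left (Nat.le_succ m) 2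
      _ ≤ (2 ^ (a + 1)) ^ 2 := Nat.pow_le_pow_left hm.le 2
      _ = 2 ^ (2 * a + 2) := by rw [← pow_mul]; ring_nf
  have h2K : 2 * K ≤ 2 ^ (j + 2) := by
    calc 2 * K ≤ 2 * 2 ^ (j + 1) := by omega
      _ = 2 ^ (j + 2) := by ring
  have hprod : m ^ 2 * (2 * K) ≤ 2 ^ (7 * a + j + 10) := by
    calc m ^ 2 * (2 * K) ≤ 2 ^ (2 * a + 2) * 2 ^ (j + 2) := Nat.mul_le_mul hsq h2K
      _ = 2 ^ (2 * a + j + 4) := by rw [← pow_add]; ring_nf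
      _ ≤ 2 ^ (7 * a + j + 10) := Nat.pow_le_pow_right (by norm_num) (by omega)
  have hA : 2 ^ (7 * a + 10) ≤ 2 ^ (7 * a + j + 10) := Nat.pow_le_pow_right (by norm_num) (by omega)
  refine ⟨?_, ?_⟩
  · calc 8 * (m + 1) ^ 7 + m ^ 2 * (2 * K) ≤ 2 ^ (7 * a + j + 10) + 2 ^ (7 * a + j + 10) :=
          Nat.add_le_add (h7'.trans hA) hprod
        _ = 2 ^ (7 * a + j + 11) := by ring
  · calc K ≤ 2 ^ (j + 1) := by omega
      _ ≤ 2 ^ (7 * a + j + 11) := Nat.pow_le_pow_right (by norm_num) (by omega)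

/-- the exponent bookkeeping: with `E = 7·log₂(m+1) + log₂(K+1) + 11` and `K ≥ 1`,
`K + (18 E² + 1) ≤ 18416 · (K + log₂² m)`. -/
theorem exponent_le (m K : ℕ) (hK : 1 ≤ K) :
    K + (18 * (7 * Nat.log 2 (m + 1) + Nat.log 2 (K + 1) + 11) ^ 2 + 1) ≤ 18416 * (K + Nat.log 2 m ^ 2) := by
  have h1 := log_succ_sq_le K
  have h2 := log_succ_le m
  set a := Nat.log 2 (m + 1)
  set j := Nat.log 2 (K + 1)
  set L := Nat.log 2 m
  have h3 : (7 * a + j + 11) ^ 2 ≤ 3 * (49 * L ^ 2 + j ^ 2 + 324) := by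
    have h4 : 7 * a + j + 11 ≤ 7 * L + j + 18 := by omega
    calc (7 * a + j + 11) ^ 2 ≤ (7 * L + j + 18) ^ 2 := Nat.pow_le_pow_left h4 2
      _ ≤ 3 * (49 * L ^ 2 + j ^ 2 + 324) := by nlinarith [sq_nonneg (7 * L - j : ℤ), sq_nonneg (7 * L - 18 : ℤ), sq_nonneg (j - 18 : ℤ)]
  nlinarith [h1, h3, Nat.zero_le (L ^ 2)]

/-- **The first lemma holds: RFL ⇒ Conjecture B** (`KPlusLogSqLaw` with `C_B = 18416·C`).  Honest scope: an implication between two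
OPEN statements; nothing is asserted about either. -/
theorem firstLemma_proof : FirstLemma := by
  rintro ⟨C, hC⟩
  refine ⟨18416 * C, fun m K => ?_⟩
  intro d S _hS
  rcases Nat.eq_zero_or_pos K with hK0 | hKpos
  · -- `K = 0`: the pencil is the zero matrix (or the empty one): no real zeros.
    subst hK0
    rcases Nat.eq_zero_or_pos m with hm0 | hmpos
    · subst hm0
      simp [Matrix.det_isEmpty]
    · haveI : Nonempty (Fin m) := ⟨⟨0, hmpos⟩⟩
      simp [Matrix.det_zero]
  · have hrow := hC K d (pencilDet S)
    rw [curveRootCount_pencilDet] at hrow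
    refine hrow.trans ?_
    obtain ⟨hsize, hKE⟩ := size_le_two_pow_E m K
    set E := 7 * Nat.log 2 (m + 1) + Nat.log 2 (K + 1) + 11 with hEdef
    have hE : 1 ≤ E := by omega
    have hf : formulaComplexity (pencilDet S) ≤ 2 ^ (18 * E ^ 2) := formulaComplexity_pencilDet_le S hE hsize hKE
    have h2 : formulaComplexity (pencilDet S) + 2 ≤ 2 ^ (18 * E ^ 2 + 1) := by
      have h18 : (2 : ℕ) ≤ 2 ^ (18 * E ^ 2) := by
        calc (2 : ℕ) = 2 ^ 1 := by norm_num
          _ ≤ 2 ^ (18 * E ^ 2) := Nat.pow_le_pow_right (by norm_num) (by nlinarith)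
      calc formulaComplexity (pencilDet S) + 2 ≤ 2 ^ (18 * E ^ 2) + 2 ^ (18 * E ^ 2) := Nat.add_le_add hf h18
        _ = 2 ^ (18 * E ^ 2 + 1) := by ring
    have hexp := exponent_le m K hKpos
    calc 2 ^ (C * K) * (formulaComplexity (pencilDet S) + 2) ^ C
        ≤ 2 ^ (C * K) * (2 ^ (18 * E ^ 2 + 1)) ^ C := Nat.mul_le_mul_left _ (Nat.pow_le_pow_left h2 C)
      _ = 2 ^ (C * (K + (18 * E ^ 2 + 1))) := by rw [← pow_mul, ← pow_add]; ring_nf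
      _ ≤ 2 ^ (18416 * C * (K + Nat.log 2 m ^ 2)) := by
          refine Nat.pow_le_pow_right (by norm_num) ?_
          calc C * (K + (18 * E ^ 2 + 1)) ≤ C * (18416 * (K + Nat.log 2 m ^ 2)) := Nat.mul_le_mul_left C hexp
            _ = 18416 * C * (K + Nat.log 2 m ^ 2) := by ring

/-- hence RFL alone closes the crux `MatrixDescartes` through the tree (`Census.matrixDescartes_of_kPlusLogSqLaw`). -/
theorem matrixDescartes_of_realFormulaLaw' (h : RealFormulaLaw) :
    Summit.ValiantsHypothesis.ValiantsHypothesis.Theses.LacunarySymmetroid.MatrixDescartes :=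
  Summit.ValiantsHypothesis.ValiantsHypothesis.Theorems.LacunarySymmetroidMatrixDescartes.Census.matrixDescartes_of_kPlusLogSqLaw
    (firstLemma_proof h)

/-- … and then the tree closes the crux: `Census.matrixDescartes_of_kPlusLogSqLaw`. -/
theorem matrixDescartes_of_realFormulaLaw (h₁ : FirstLemma) (h : RealFormulaLaw) :
    Summit.ValiantsHypothesis.ValiantsHypothesis.Theses.LacunarySymmetroid.MatrixDescartes :=
  Summit.ValiantsHypothesis.ValiantsHypothesis.Theorems.LacunarySymmetroidMatrixDescartes.Census.matrixDescartes_of_kPlusLogSqLaw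
    (h₁ h)

/-- **WLL — the width–length law**, RFL read on iterated matrix multiplication (the located family of new predictions):
an entry of a product of `L` real `w × w` matrices with entries in `span{t^{d_l}}` has at most
`2^{C (K + log₂L·(log₂w + 1) + 1)}` distinct real zeros (`(2w)^{⌈log₂ L⌉}` = divide-and-conquer formula size of `IMM_{w,L}`).
`w = 1`: `≤ L(K−1)` (Descartes, sharp order); tropical mirror = the tree's Gusfield bound `chainBound_walkFam_clog`;
the determinant is the case `w = O(m²), L = m` (Mahajan–Vinay), giving back the exponent `K + log² m`. A CONJECTURE.
PRICE LINE (val-idea-crit-4 VERDICT #4 P1 / Pr2, 2026-08-28; adopted by the seat, rev 2): at FIXED width this bound is POLYNOMIAL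
in `L`, and every fixed-width-polynomial member of the family (RFL, W3L, WLL) implies `DET ∉ VF` over `ℝ` (`VF_ℝ ≠ VBP_ℝ`) through
the tree's real staircase pencils — kernel for RFL: `FormulaLawSandwich.not_detInVF_of_realFormulaLaw` in
`Cruxes/MatrixDescartes/LENS_embed_g3_FormulaLawSandwich.lean`.  It is therefore NOT advertised as the natural Gusfield-shaped law:
the unpriced host of record is the quasi-polynomial grade (`FormulaLawSandwich.FormulaLaw 2`; RAL of `imm-length-halving`), for
which `B ⟹ FormulaLaw 2 ⟹ PencilLaw 4 ⟹ MatrixDescartes` is kernel-checked there.  Never a route crux, never a prover target. -/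
def WidthLengthLaw : Prop :=
  ∃ C : ℕ, ∀ (w L K : ℕ) (d : Fin K → ℕ) (c : Fin L → Fin w → Fin w → Fin K → ℝ) (a b : Fin w),
    (((List.ofFn fun i : Fin L =>
        Matrix.of fun x y : Fin w => ∑ l, Polynomial.C (c i x y l) * (Polynomial.X : Polynomial ℝ) ^ d l).prod) a b
      ).roots.toFinset.card ≤ 2 ^ (C * (K + Nat.log 2 L * (Nat.log 2 w + 1) + 1))

/-! ### Width three suffices (Brent + Ben-Or–Cleve, both in the tree) -/

/-- a LETTER MATRIX: a `3 × 3` matrix each of whose entries is a letter `y_l` or a real constant (the letters of Ben-Or–Cleve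
register programs; on the curve `y_l = t^{d_l}` every entry is a monomial `c` or `t^{d_l}`: a lacunary SHEAR/letter product). -/
def IsLetterMatrix {K : ℕ} (M : Matrix (Fin 3) (Fin 3) (MvPolynomial (Fin K) ℝ)) : Prop :=
  ∀ a b, (∃ x, M a b = MvPolynomial.X x) ∨ ∃ c, M a b = MvPolynomial.C c

/-- **W3L — the width-three letter law** (a CONJECTURE, never asserted; PRICED like RFL — polynomial in `L` at width 3, hence
`W3L ⟹ RFL ⟹ DET ∉ VF_ℝ`, crit-4 VERDICT #4 P1 / rev 2): the `(0,2)` entry of a product of `L` letter matrices,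
read on the curve `y_l = t^{d_l}`, has at most `2^{C·K} · (L+2)^C` distinct real zeros.  Trivially implied by RFL (the entry has
formula size `O(L^{log₂ 6})` by divide and conquer); the converse is `realFormulaLaw_of_widthThreeLaw` below. -/
def WidthThreeLaw : Prop :=
  ∃ C : ℕ, ∀ (K : ℕ) (d : Fin K → ℕ) (w : List (Matrix (Fin 3) (Fin 3) (MvPolynomial (Fin K) ℝ))),
    (∀ M ∈ w, IsLetterMatrix M) → curveRootCount d (w.prod 0 2) ≤ 2 ^ (C * K) * (w.length + 2) ^ C

/-- arithmetic for `realFormulaLaw_of_widthThreeLaw`: word length vs formula size. -/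
theorem wordLength_le (E δ ℓ : ℕ) (hδ : 4 ^ δ ≤ (E + 1) ^ 16) (hℓ : ℓ ≤ 6 * 4 ^ δ) : ℓ + 2 ≤ (E + 2) ^ 19 := by
  have h16 : (E + 1) ^ 16 ≤ (E + 2) ^ 16 := Nat.pow_le_pow_left (by omega) 16
  have hpos : 1 ≤ (E + 2) ^ 16 := Nat.one_le_pow _ _ (by omega)
  have h8 : 8 ≤ (E + 2) ^ 3 := by
    calc (8 : ℕ) = 2 ^ 3 := by norm_num
      _ ≤ (E + 2) ^ 3 := Nat.pow_le_pow_left (by omega) 3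
  have hd : 4 ^ δ ≤ (E + 2) ^ 16 := hδ.trans h16
  calc ℓ + 2 ≤ 6 * 4 ^ δ + 2 := Nat.add_le_add_right hℓ 2
    _ ≤ 6 * (E + 2) ^ 16 + 2 * (E + 2) ^ 16 := Nat.add_le_add (Nat.mul_le_mul_left 6 hd) (by omega)
    _ = 8 * (E + 2) ^ 16 := by ring
    _ ≤ (E + 2) ^ 3 * (E + 2) ^ 16 := Nat.mul_le_mul_right _ h8
    _ = (E + 2) ^ 19 := by rw [← pow_add]

/-- arithmetic for `realFormulaLaw_of_widthThreeLaw`: monotonicity of the final bound. -/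
theorem widthThree_bound_mono (C K E ℓ : ℕ) (hℓ : ℓ + 2 ≤ (E + 2) ^ 19) :
    2 ^ (C * K) * (ℓ + 2) ^ C ≤ 2 ^ (19 * C * K) * (E + 2) ^ (19 * C) := by
  have hCK : C * K ≤ 19 * C * K := by
    calc C * K = 1 * (C * K) := (one_mul _).symm
      _ ≤ 19 * (C * K) := Nat.mul_le_mul_right _ (by norm_num)
      _ = 19 * C * K := (mul_assoc _ _ _).symm
  calc 2 ^ (C * K) * (ℓ + 2) ^ C
      ≤ 2 ^ (C * K) * ((E + 2) ^ 19) ^ C := Nat.mul_le_mul_left _ (Nat.pow_le_pow_left hℓ C)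
    _ = 2 ^ (C * K) * (E + 2) ^ (19 * C) := by rw [← pow_mul]
    _ ≤ 2 ^ (19 * C * K) * (E + 2) ^ (19 * C) := Nat.mul_le_mul_right _ (Nat.pow_le_pow_right (by norm_num) hCK)

/-- **W3L ⇒ RFL** (Brent: a formula of size `E` has an equivalent formula of depth `δ` with `4^δ ≤ (E+1)^16`,
`exists_formula_four_pow_depth_le`; Ben-Or–Cleve: a depth-`δ` formula is the `(0,2)` entry of a product of `≤ 6·4^δ` letter
matrices, `BenOrCleve.exists_word_of_circuit`).  Hence W3L ⇒ RFL ⇒ B ⇒ `MatrixDescartes`, all arrows kernel-checked. -/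
theorem realFormulaLaw_of_widthThreeLaw : WidthThreeLaw → RealFormulaLaw := by
  rintro ⟨C, hC⟩
  refine ⟨19 * C, fun K d P => ?_⟩
  obtain ⟨Q, -, -, hQ2, hQe, hQd⟩ := exists_formula_four_pow_depth_le P
  obtain ⟨w, hwlen, hwletters, hwprod⟩ := BenOrCleve.exists_word_of_circuit Q hQ2
  have h02 : ((0 : Fin 3) ≠ 2) := by decide
  have hentry : w.prod 0 2 = P := by
    have h := congrArg (fun M : Matrix (Fin 3) (Fin 3) (MvPolynomial (Fin K) ℝ) => M 0 2) hwprod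
    simp only [Matrix.transvection, Matrix.add_apply, Matrix.single_apply_same, Matrix.one_apply_ne h02,
      zero_add] at h
    rw [h, hQe]
  have hletters : ∀ M ∈ w, IsLetterMatrix M := fun M hM => hwletters M hM
  have h1 : curveRootCount d (w.prod 0 2) ≤ 2 ^ (C * K) * (w.length + 2) ^ C := hC K d w hletters
  rw [hentry] at h1
  exact h1.trans (widthThree_bound_mono C K (formulaComplexity P) w.length
    (wordLength_le (formulaComplexity P) Q.depth w.length hQd hwlen))

/-- so the crux (and, through the route `LacunarySymmetroid`, the summit) would follow from W3L alone — an implication between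
OPEN statements; nothing is asserted about W3L. -/
theorem matrixDescartes_of_widthThreeLaw (h : WidthThreeLaw) :
    Summit.ValiantsHypothesis.ValiantsHypothesis.Theses.LacunarySymmetroid.MatrixDescartes :=
  matrixDescartes_of_realFormulaLaw' (realFormulaLaw_of_widthThreeLaw h)

/-! ### Cross-note for the tropical crux `TropicalB` (stmt-ValiantsHypothesis-19771) and the summit -/

/-- RFL ⇒ `TropicalB`, through the REAL side (B ⇒ TB is the tree's patchworking bridge `tropKPlusLogSqLaw_of_kPlusLogSqLaw`;
`TropicalB` is δ-equal to `TropicalCensus.TropKPlusLogSqLaw`).  The tropical statement inherits a CANCELLATIVE reason: the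
tropical determinant has no subexponential monotone/tropical formula (Jerrum–Snir), so no tropical-formula induction reaches TB,
while the real determinant's quasi-polynomial formula does, if RFL holds. -/
theorem tropicalB_of_realFormulaLaw (h : RealFormulaLaw) :
    Summit.ValiantsHypothesis.ValiantsHypothesis.Theses.KPlusLogSqLaw.TropicalB :=
  Summit.ValiantsHypothesis.ValiantsHypothesis.Theorems.LacunarySymmetroidMatrixDescartes.TropicalCensus.tropKPlusLogSqLaw_of_kPlusLogSqLaw
    (firstLemma_proof h)

/-- and W3L ⇒ the summit statement, by the route `LacunarySymmetroid` (its other two cruxes are tree theorems: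
`pencilTransfer_proof`, `thetaWitness_proof`).  An implication from an OPEN hypothesis; VP ≠ VNP is NOT proved here. -/
theorem valiant_of_widthThreeLaw (h : WidthThreeLaw) : _root_.ValiantsHypothesis :=
  Summit.ValiantsHypothesis.ValiantsHypothesis.Theorems.lacunarySymmetroid_assembly_proof
    (matrixDescartes_of_widthThreeLaw h)
    Summit.ValiantsHypothesis.ValiantsHypothesis.Theorems.LacunarySymmetroid.pencilTransfer_proof
    Summit.ValiantsHypothesis.ValiantsHypothesis.Theorems.LacunarySymmetroid.thetaWitness_proof

end Summit.ValiantsHypothesis.ValiantsHypothesis.Cruxes.MatrixDescartes.LacunaryFormulaLaw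

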